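import Mathlib.Analysis.Meromorphic.Order
import Mathlib.Analysis.Complex.CauchyIntegral
import Mathlib.Analysis.Complex.Convex
import HarnessLib

/-!
# Entire continuation of an L-function from a one-sided continuation and a functional equation

A standard piece of complex-analytic bookkeeping, used whenever an Euler product `L(s)` is
compared with an automorphic L-function only at the *unramified* places (so that only a
continuation of `L` to a right half-plane, with the finitely many remaining local factors as
possible sources of poles further left, is available), while `L` and its dual `L'` are known
to satisfy a functional equation of Hecke–Artin type `Λ(1 - s) = W Λ'(s)`,
`Λ = γ · L`, `Λ' = γ' · L'` with meromorphic `Λ, Λ'`: if `L` and `L'` both continue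
holomorphically to `re s > c` for some `c < 1/2`, the archimedean factors `γ, γ'` are
holomorphic there and `γ` has an entire inverse, then `L` is entire.  Indeed the functional
equation transports the continuation of `L'` on `re s > c` to a holomorphic function on
`re s < 1 - c`, which agrees with the continuation of `L` on the strip `c < re s < 1 - c` by
the identity principle for meromorphic functions on the half-plane `re s > c`; the two glue to
an entire function.  (This is how, e.g., the entirety of the Artin L-function of a Galois
representation `σ` follows from the automorphy of `σ` at almost all places together with
Artin's functional equation, without any local comparison at the ramified places: Deligne–Serre,
*Formes modulaires de poids 1* (1974), proof of Thm. 4.6 and Lemma 4.9 use the same device of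
playing the two functional equations against a finite set of local factors; Jacquet–Langlands,
LNM 114 (1970), Thm. 11.1 and Cor. 11.2 for the automorphic side.)

Main results (all **proved**, Mathlib only):

* `eventuallyEq_zero_of_eqOn_halfPlane` — identity principle on a right half-plane: a function
  meromorphic on `{re s > c}` which vanishes on `{re s > x₀}` vanishes on a punctured
  neighbourhood of every point of `{re s > c}` (Mathlib
  `MeromorphicOn.meromorphicOrderAt_ne_top_of_isPreconnected`).
* `exists_entire_extension_of_functionalEquation` — the gluing statement above, with conclusion
  "some entire `g` agrees with the given continuation `E` of `L` on `re s > c`".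
* `exists_entire_eq_of_functionalEquation` — the same with conclusion "some entire `g` agrees
  with `L` on `re s > 1`" (the shape of `LFunction.HasEntireContinuation` in
  `Literature.NumberTheory.GaloisRepresentations.ArtinLFunction`, not imported here to keep this
  file Mathlib-only).

Design: pointwise values of a Mathlib-`Meromorphic` function are not determined by its germ
(`MeromorphicAt` ignores the value at the point), so the functional equation is only ever used
on punctured neighbourhoods, where `Λ = γ E` and `Λ' = γ' E'` hold eventually; equality of the
two holomorphic candidates at a point of the strip is then recovered from their continuity.
No `Literature` import; nothing here duplicates a Mathlib declaration (`lean search` for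
`hasEntireContinuation_of`, `functional` + `Differentiable`: no abstract statement of this kind
in Mathlib or the tree; the tree's `GodementJacquetPartialL` has the *meromorphic* half-plane
upgrade `exists_meromorphic_eqOn_halfPlane`, whose identity-principle step is reused here in
`eventuallyEq_zero_of_eqOn_halfPlane`).

## References

* P. Deligne, J.-P. Serre, *Formes modulaires de poids 1*, Ann. Sci. ÉNS (4) 7 (1974),
  proof of Thm. 4.6 (iii)–(iv), Lemma 4.9. [DeligneSerreASENS1974]
* H. Jacquet, R. P. Langlands, *Automorphic Forms on GL(2)*, LNM 114 (1970), Thm. 11.1,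
  Cor. 11.2. [JacquetLanglands1970]
-/

noncomputable section

open Set Filter Topology

namespace Literature.NumberTheory.LFunctions

/-- **Identity principle on a right half-plane.**  If `N` is meromorphic on the half-plane
`U = {re s > c}` and vanishes at every point of a smaller half-plane `{re s > x₀}`, then `N`
vanishes on a punctured neighbourhood of every point of `U` (its meromorphic order is `⊤`
everywhere on the preconnected `U`, Mathlib
`MeromorphicOn.meromorphicOrderAt_ne_top_of_isPreconnected`).  Pointwise vanishing on `U` does
not follow (and is false in general for Mathlib's `MeromorphicAt`). [folklore] -/
theorem eventuallyEq_zero_of_eqOn_halfPlane {c x₀ : ℝ} {N : ℂ → ℂ}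
    (hN : MeromorphicOn N {s : ℂ | c < s.re}) (h0 : ∀ s : ℂ, x₀ < s.re → N s = 0)
    {x : ℂ} (hx : c < x.re) : ∀ᶠ z in 𝓝[≠] x, N z = 0 := by
  set U : Set ℂ := {s : ℂ | c < s.re}
  -- a point far to the right where `N` vanishes identically nearby
  set s₁ : ℂ := ((max x₀ c + 1 : ℝ) : ℂ) with hs₁
  have hs₁re : s₁.re = max x₀ c + 1 := by rw [hs₁, Complex.ofReal_re]
  have hs₁U : s₁ ∈ U := by
    show c < s₁.re
    rw [hs₁re]
    exact (le_max_right x₀ c).trans_lt (lt_add_one _)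
  have h₁ : meromorphicOrderAt N s₁ = ⊤ := by
    rw [meromorphicOrderAt_eq_top_iff]
    apply eventually_nhdsWithin_of_eventually_nhds
    have hmem : {s : ℂ | max x₀ c < s.re} ∈ 𝓝 s₁ :=
      (isOpen_lt continuous_const Complex.continuous_re).mem_nhds
        (show max x₀ c < s₁.re by rw [hs₁re]; exact lt_add_one _)
    filter_upwards [hmem] with z hz
    exact h0 z ((le_max_left x₀ c).trans_lt hz)
  have htop : meromorphicOrderAt N x = ⊤ := by
    by_contra hne
    exact hN.meromorphicOrderAt_ne_top_of_isPreconnected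
      (convex_halfSpace_re_gt c).isPreconnected hx hs₁U hne h₁
  exact meromorphicOrderAt_eq_top_iff.1 htop

/-- Punctured neighbourhoods are mapped to punctured neighbourhoods by the reflection
`z ↦ 1 - z`. [folklore] -/
theorem tendsto_one_sub_nhdsNE (x : ℂ) :
    Tendsto (fun z : ℂ => 1 - z) (𝓝[≠] x) (𝓝[≠] (1 - x)) := by
  refine tendsto_nhdsWithin_of_tendsto_nhds_of_eventually_within _
    (((continuous_const.sub continuous_id).tendsto x).mono_left nhdsWithin_le_nhds) ?_
  filter_upwards [self_mem_nhdsWithin] with z hz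
  simp only [mem_compl_iff, mem_singleton_iff] at hz ⊢
  exact fun h => hz (sub_right_injective h)

/-- **Entire continuation from a one-sided continuation and a functional equation.**  Let
`c < 1/2`.  Suppose
* `E`, `E'` are holomorphic on `re s > c` and agree with `L`, `L'` on `re s > 1`;
* `γ`, `γ'` are holomorphic on `re s > c`, and `γinv` is entire with `γ · γinv = 1` on
  `re s > c`;
* `Λ`, `Λ'` are meromorphic on `re s > c`, `Λ = γ L` and `Λ' = γ' L'` on `re s > 1`, and
  `Λ(1 - s) = W Λ'(s)` for all `s`.
Then some entire function agrees with `E` on `re s > c`.  Proof: on `re s > c`,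
`Λ = γ E` and `Λ' = γ' E'` on punctured neighbourhoods (identity principle); hence on the
strip `c < re s < 1 - c`, puncturedly near each point,
`γ(z) E(z) = Λ(z) = W Λ'(1 - z) = W γ'(1 - z) E'(1 - z)`, so `E` agrees there with the
holomorphic function `h₂(s) = W γ'(1 - s) E'(1 - s) γinv(s)` of `re s < 1 - c` (by continuity
at the point itself); `E` on `re s > c` and `h₂` on `re s ≤ c` glue to an entire function.
[folklore] -/
theorem exists_entire_extension_of_functionalEquation {c : ℝ} (hc : c < 1 / 2)
    {L L' Λ Λ' γ γ' γinv E E' : ℂ → ℂ} {W : ℂ}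
    (hE : DifferentiableOn ℂ E {s : ℂ | c < s.re}) (hEL : ∀ s : ℂ, 1 < s.re → E s = L s)
    (hE' : DifferentiableOn ℂ E' {s : ℂ | c < s.re}) (hE'L' : ∀ s : ℂ, 1 < s.re → E' s = L' s)
    (hγ : DifferentiableOn ℂ γ {s : ℂ | c < s.re})
    (hγ' : DifferentiableOn ℂ γ' {s : ℂ | c < s.re})
    (hγinv : Differentiable ℂ γinv) (hγγ : ∀ s : ℂ, c < s.re → γ s * γinv s = 1)
    (hΛ : MeromorphicOn Λ {s : ℂ | c < s.re}) (hΛ' : MeromorphicOn Λ' {s : ℂ | c < s.re})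
    (hΛL : ∀ s : ℂ, 1 < s.re → Λ s = γ s * L s)
    (hΛ'L' : ∀ s : ℂ, 1 < s.re → Λ' s = γ' s * L' s)
    (hFE : ∀ s : ℂ, Λ (1 - s) = W * Λ' s) :
    ∃ g : ℂ → ℂ, Differentiable ℂ g ∧ ∀ s : ℂ, c < s.re → g s = E s := by
  classical
  set U : Set ℂ := {s : ℂ | c < s.re} with hU
  set V : Set ℂ := {s : ℂ | s.re < 1 - c} with hV
  have hUo : IsOpen U := isOpen_lt continuous_const Complex.continuous_re
  have hVo : IsOpen V := isOpen_lt Complex.continuous_re continuous_const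
  have hEan : AnalyticOnNhd ℂ E U := hE.analyticOnNhd hUo
  have hE'an : AnalyticOnNhd ℂ E' U := hE'.analyticOnNhd hUo
  have hγan : AnalyticOnNhd ℂ γ U := hγ.analyticOnNhd hUo
  have hγ'an : AnalyticOnNhd ℂ γ' U := hγ'.analyticOnNhd hUo
  -- Step A: `Λ = γ E` puncturedly near every point of `U`
  have hA : ∀ x ∈ U, ∀ᶠ z in 𝓝[≠] x, Λ z = γ z * E z := by
    intro x hx
    have hN : MeromorphicOn (fun s => Λ s - γ s * E s) U := fun s hs =>
      (hΛ s hs).sub (((hγan s hs).mul (hEan s hs)).meromorphicAt)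
    have h0 : ∀ s : ℂ, 1 < s.re → Λ s - γ s * E s = 0 := fun s hs => by
      rw [hΛL s hs, hEL s hs, sub_self]
    filter_upwards [eventuallyEq_zero_of_eqOn_halfPlane hN h0 hx] with z hz
    exact sub_eq_zero.1 hz
  -- Step B: `Λ' = γ' E'` puncturedly near every point of `U`
  have hB : ∀ x ∈ U, ∀ᶠ z in 𝓝[≠] x, Λ' z = γ' z * E' z := by
    intro x hx
    have hN : MeromorphicOn (fun s => Λ' s - γ' s * E' s) U := fun s hs =>
      (hΛ' s hs).sub (((hγ'an s hs).mul (hE'an s hs)).meromorphicAt)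
    have h0 : ∀ s : ℂ, 1 < s.re → Λ' s - γ' s * E' s = 0 := fun s hs => by
      rw [hΛ'L' s hs, hE'L' s hs, sub_self]
    filter_upwards [eventuallyEq_zero_of_eqOn_halfPlane hN h0 hx] with z hz
    exact sub_eq_zero.1 hz
  -- Step C: the reflected candidate on `V`
  set h₂ : ℂ → ℂ := fun s => W * (γ' (1 - s) * E' (1 - s)) * γinv s with hh₂
  have hmaps : MapsTo (fun s : ℂ => 1 - s) V U := fun s hs => by
    show c < (1 - s).re
    rw [Complex.sub_re, Complex.one_re]
    have := hs.out
    linarith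
  have hrefl : Differentiable ℂ fun s : ℂ => 1 - s :=
    (differentiable_const (1 : ℂ)).sub differentiable_id
  have hh₂V : DifferentiableOn ℂ h₂ V :=
    ((((hγ'.comp hrefl.differentiableOn hmaps).mul
      (hE'.comp hrefl.differentiableOn hmaps)).const_mul W).mul hγinv.differentiableOn)
  -- Step D: agreement on the strip
  have hD : ∀ x : ℂ, c < x.re → x.re < 1 - c → E x = h₂ x := by
    intro x hxU hxV
    have h1x : (1 - x) ∈ U := hmaps hxV
    have hBx : ∀ᶠ z in 𝓝[≠] x, Λ' (1 - z) = γ' (1 - z) * E' (1 - z) :=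
      (tendsto_one_sub_nhdsNE x).eventually (hB (1 - x) h1x)
    have hUx : ∀ᶠ z in 𝓝[≠] x, z ∈ U :=
      eventually_nhdsWithin_of_eventually_nhds (hUo.mem_nhds hxU)
    have hev : ∀ᶠ z in 𝓝[≠] x, E z = h₂ z := by
      filter_upwards [hA x hxU, hBx, hUx] with z hz hz' hzU
      have hfe : Λ z = W * Λ' (1 - z) := by
        have := hFE (1 - z)
        rwa [sub_sub_cancel] at this
      calc E z = γ z * γinv z * E z := by rw [hγγ z hzU, one_mul]
        _ = γinv z * (γ z * E z) := by ring
        _ = γinv z * (W * (γ' (1 - z) * E' (1 - z))) := by rw [← hz, hfe, hz']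
        _ = h₂ z := by rw [hh₂]; ring
    -- both sides are continuous at `x`
    have hcE : ContinuousAt E x := (hEan x hxU).continuousAt
    have hch : ContinuousAt h₂ x := (hh₂V.differentiableAt (hVo.mem_nhds hxV)).continuousAt
    have ht₁ : Tendsto E (𝓝[≠] x) (𝓝 (E x)) := hcE.tendsto.mono_left nhdsWithin_le_nhds
    have ht₂ : Tendsto E (𝓝[≠] x) (𝓝 (h₂ x)) :=
      (hch.tendsto.mono_left nhdsWithin_le_nhds).congr' (hev.mono fun z hz => hz.symm)
    exact tendsto_nhds_unique ht₁ ht₂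
  -- Step E: glue
  refine ⟨fun s => if c < s.re then E s else h₂ s, fun s => ?_, fun s hs => if_pos hs⟩
  by_cases hs : c < s.re
  · have hev : (fun s => if c < s.re then E s else h₂ s) =ᶠ[𝓝 s] E := by
      filter_upwards [hUo.mem_nhds hs] with z hz
      exact if_pos hz
    exact hev.differentiableAt_iff.2 (hE.differentiableAt (hUo.mem_nhds hs))
  · have hsV : s ∈ V := by
      show s.re < 1 - c
      linarith [not_lt.1 hs]
    have hev : (fun s => if c < s.re then E s else h₂ s) =ᶠ[𝓝 s] h₂ := by
      filter_upwards [hVo.mem_nhds hsV] with z hz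
      by_cases hzU : c < z.re
      · rw [if_pos hzU]
        exact hD z hzU hz
      · rw [if_neg hzU]
    exact hev.differentiableAt_iff.2 (hh₂V.differentiableAt (hVo.mem_nhds hsV))

/-- **Entire continuation from a one-sided continuation and a functional equation**
(`L`-form).  Under the hypotheses of `exists_entire_extension_of_functionalEquation`, some
entire function agrees with `L` on `re s > 1` — the shape of
`LFunction.HasEntireContinuation L` in `Literature.NumberTheory.GaloisRepresentations.ArtinLFunction`.
[folklore] -/
theorem exists_entire_eq_of_functionalEquation {c : ℝ} (hc : c < 1 / 2)
    {L L' Λ Λ' γ γ' γinv E E' : ℂ → ℂ} {W : ℂ}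
    (hE : DifferentiableOn ℂ E {s : ℂ | c < s.re}) (hEL : ∀ s : ℂ, 1 < s.re → E s = L s)
    (hE' : DifferentiableOn ℂ E' {s : ℂ | c < s.re}) (hE'L' : ∀ s : ℂ, 1 < s.re → E' s = L' s)
    (hγ : DifferentiableOn ℂ γ {s : ℂ | c < s.re})
    (hγ' : DifferentiableOn ℂ γ' {s : ℂ | c < s.re})
    (hγinv : Differentiable ℂ γinv) (hγγ : ∀ s : ℂ, c < s.re → γ s * γinv s = 1)
    (hΛ : MeromorphicOn Λ {s : ℂ | c < s.re}) (hΛ' : MeromorphicOn Λ' {s : ℂ | c < s.re})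
    (hΛL : ∀ s : ℂ, 1 < s.re → Λ s = γ s * L s)
    (hΛ'L' : ∀ s : ℂ, 1 < s.re → Λ' s = γ' s * L' s)
    (hFE : ∀ s : ℂ, Λ (1 - s) = W * Λ' s) :
    ∃ g : ℂ → ℂ, Differentiable ℂ g ∧ ∀ s : ℂ, 1 < s.re → g s = L s := by
  obtain ⟨g, hg, hgE⟩ := exists_entire_extension_of_functionalEquation hc hE hEL hE' hE'L' hγ
    hγ' hγinv hγγ hΛ hΛ' hΛL hΛ'L' hFE
  exact ⟨g, hg, fun s hs => (hgE s (by linarith)).trans (hEL s hs)⟩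

end Literature.NumberTheory.LFunctions

end
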